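import Mathlib
import Summits.ValiantsHypothesis.ValiantsHypothesis.Theorems.FifoMatchingNNLinearDegreeCofactorHardBlockWalkBand
import HarnessLib

/-!
# Route FifoMatching — crux `NNLinearDegreeCofactorHard` (stmt-ValiantsHypothesis-23918), line `internal_cofactor`:
# stub S2b, unit (E″) — the band estimate for the PAIR WALK of SPEC S2/S7

SPEC `Lines/internal_cofactor-S2b-SPEC.md` (acting lead p4), items S2/S7: the randomness of the (ii) measure is a
uniform bit string `y : Fin (2J) → Bool`; pair `j` reads bits `(2j, 2j+1)` through one of two decoders,
NEUTRAL `(0,0)↦DD (0,1)↦DU (1,0)↦UD (1,1)↦UU` or INFLATE `(0,0)↦UU (0,1)↦UD (1,0)↦DU (1,1)↦UU`, according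
to a schedule `τ : Fin J → Bool` (`τ j = true` = inflate) that is deterministic in `R`.  The height
increment of pair `j` minus its mean (`0` for neutral, `+1` for inflate) is the CENTRED PAIR STEP
`X_j ∈ {−2,0,0,2}` (neutral: `±1 ± 1`) resp. `{+1,−1,−1,+1}` (inflate: `+1` iff the two bits agree); the
envelope `H` of S3 absorbs the means and the (deterministic) `R`-pops, so `h − H` along the middle is the
walk `S_t = ∑_{j<t} X_j` up to an additive constant `≤ 3` (head overshoot ≤ 2, S4; half a pair ≤ 1).
This file bounds the number of bit strings whose pair walk leaves the band:

* `pairStep_mem_Icc`, `coordMean_pairStep` — the centred pair step lies in `[−2, 2]` and has mean `0`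
  under both decoders;
* `card_filter_pairWalk_exits_le` — **`#{y : ∃ t ≤ J, m ≤ |S_t(y)|} ≤ 2J · exp(−m²/(8J)) · 4^J`**
  (`…BlockWalkBand.card_filter_exists_abs_prefix_centered_ge_le` on the blocks `Fin J → (Fin 2 → Bool)`,
  width `w = 4`, transported to the flat bit string along `y ↦ (j ↦ (k ↦ y (2j+k)))`).

What remains for S7 verbatim is the bookkeeping `¬Band y ⇒ ∃ t ≤ J, m − 3 ≤ |S_t(y)|` against the word of
unit (A″) (`inflateWord`, not yet in the tree).  Honest framing: elementary counting for one unit of one stub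
of an OPEN crux; nothing here bears on the crux, `NNDivisionHard`, `NNNotVP` or `VP ≠ VNP` (NOT proved).  No
definitions (the decoders are written out), no named facts. [folklore]
-/

noncomputable section

-- Sub = Summit single-conjunct layout: the duplicated namespace component is mandated by the tree.
set_option linter.dupNamespace false

namespace Summit.ValiantsHypothesis.ValiantsHypothesis.Theorems.FifoMatching.NNLinearDegreeCofactorHard.InternalCofactor

open Finset Real Literature.Probability.Moments

/-! ### The centred pair step (SPEC S2 decoders) -/
/-- The centred pair step lies in `[−2, −2 + 4]`. [folklore] -/
theorem pairStep_mem_Icc (τ : Bool) (u : Fin 2 → Bool) :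
    (if τ then (if u 0 = u 1 then (1 : ℝ) else -1)
      else ((if u 0 then (1 : ℝ) else -1) + (if u 1 then (1 : ℝ) else -1))) ∈
      Set.Icc (-2 : ℝ) (-2 + 4) := by
  cases τ <;> cases u 0 <;> cases u 1 <;> norm_num

/-- The centred pair step has mean `0` under both decoders. [folklore] -/
theorem coordMean_pairStep (τ : Bool) :
    coordMean (fun u : Fin 2 → Bool => if τ then (if u 0 = u 1 then (1 : ℝ) else -1)
      else ((if u 0 then (1 : ℝ) else -1) + (if u 1 then (1 : ℝ) else -1))) = 0 := by
  rw [coordMean, div_eq_zero_iff]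
  left
  -- enumerate the four blocks `Fin 2 → Bool` through `(u 0, u 1)`
  have key : ∀ f : (Fin 2 → Bool) → ℝ,
      ∑ u : Fin 2 → Bool, f u = f ![false, false] + f ![false, true] + f ![true, false] + f ![true, true] := by
    intro f
    rw [← (Equiv.sum_comp (finTwoArrowEquiv Bool).symm f)]
    simp [Fintype.sum_prod_type, finTwoArrowEquiv, add_assoc]
    ring
  rw [key]
  cases τ <;> simp

/-! ### Flat bits versus pair blocks -/
/-- Reading the flat bit string in pairs: `y ↦ (j ↦ (k ↦ y (2j + k)))` is a bijection
`(Fin (2J) → Bool) ≃ (Fin J → Fin 2 → Bool)` (written out, no definition). [folklore] -/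
theorem pairs_bijective (J : ℕ) :
    Function.Bijective (fun (y : Fin (2 * J) → Bool) (j : Fin J) (k : Fin 2) =>
      y ⟨2 * j.val + k.val, by have := j.isLt; have := k.isLt; omega⟩) := by
  constructor
  · intro y₁ y₂ h
    funext i
    have hi := i.isLt
    have := congrFun (congrFun h ⟨i.val / 2, by omega⟩) ⟨i.val % 2, by omega⟩
    simp only at this
    have heq : (⟨2 * (i.val / 2) + i.val % 2, by omega⟩ : Fin (2 * J)) = i := Fin.ext (by simp; omega)
    rwa [heq] at this
  · intro z
    refine ⟨fun i => z ⟨i.val / 2, by have := i.isLt; omega⟩ ⟨i.val % 2, by omega⟩, ?_⟩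
    funext j k
    have hk := k.isLt
    simp only
    congr 1
    · exact Fin.ext (by simp; omega)
    · exact Fin.ext (by simp; omega)

/-! ### The band estimate for the pair walk -/
/-- **Band estimate for the pair walk (SPEC S7 core).**  For `J ≥ 1` pairs with decoder schedule `τ`
and `m > 0`, the number of bit strings `y : Fin (2J) → Bool` whose centred pair walk
`S_t(y) = ∑_{j<t} X_j(y)` reaches `|S_t| ≥ m` at some `t ≤ J` is at most `2J · exp(−m²/(8J)) · 4^J`.
[folklore] -/
theorem card_filter_pairWalk_exits_le {J : ℕ} (τ : Fin J → Bool) {m : ℝ} (hm : 0 < m) :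
    ((univ.filter fun y : Fin (2 * J) → Bool => ∃ t : ℕ, t ≤ J ∧
        m ≤ |∑ j : Fin J, (if (j : ℕ) < t then
          (if τ j then
            (if y ⟨2 * j.val, by have := j.isLt; omega⟩ = y ⟨2 * j.val + 1, by have := j.isLt; omega⟩
              then (1 : ℝ) else -1)
           else ((if y ⟨2 * j.val, by have := j.isLt; omega⟩ then (1 : ℝ) else -1) +
             (if y ⟨2 * j.val + 1, by have := j.isLt; omega⟩ then (1 : ℝ) else -1)))
          else 0)|).card : ℝ)
      ≤ 2 * J * Real.exp (-(m ^ 2 / (8 * J))) * 4 ^ J := by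
  classical
  -- the blocks and the centred steps
  set g : ∀ _ : Fin J, (Fin 2 → Bool) → ℝ := fun j u =>
    if τ j then (if u 0 = u 1 then (1 : ℝ) else -1)
    else ((if u 0 then (1 : ℝ) else -1) + (if u 1 then (1 : ℝ) else -1)) with hg
  have hband := card_filter_exists_abs_prefix_centered_ge_le (κ := fun _ : Fin J => Fin 2 → Bool)
    g (fun _ => -2) (w := 4) (by norm_num) (fun j u => pairStep_mem_Icc (τ j) u) hm
  have hmean : ∀ j, coordMean (g j) = 0 := fun j => coordMean_pairStep (τ j)
  simp only [hmean, sub_zero] at hband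
  -- transport along the pairing bijection
  set e := Equiv.ofBijective _ (pairs_bijective J) with he
  have hcard : ((univ.filter fun y : Fin (2 * J) → Bool => ∃ t : ℕ, t ≤ J ∧
      m ≤ |∑ j : Fin J, (if (j : ℕ) < t then g j (e y j) else 0)|).card) =
      ((univ.filter fun z : Fin J → Fin 2 → Bool => ∃ t : ℕ, t ≤ J ∧
        m ≤ |∑ j : Fin J, (if (j : ℕ) < t then g j (z j) else 0)|).card) := by
    rw [← map_univ_equiv e, filter_map, card_map]
    rfl
  have hlhs : (univ.filter fun y : Fin (2 * J) → Bool => ∃ t : ℕ, t ≤ J ∧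
        m ≤ |∑ j : Fin J, (if (j : ℕ) < t then
          (if τ j then
            (if y ⟨2 * j.val, by have := j.isLt; omega⟩ = y ⟨2 * j.val + 1, by have := j.isLt; omega⟩
              then (1 : ℝ) else -1)
           else ((if y ⟨2 * j.val, by have := j.isLt; omega⟩ then (1 : ℝ) else -1) +
             (if y ⟨2 * j.val + 1, by have := j.isLt; omega⟩ then (1 : ℝ) else -1)))
          else 0)|) =
      (univ.filter fun y : Fin (2 * J) → Bool => ∃ t : ℕ, t ≤ J ∧
        m ≤ |∑ j : Fin J, (if (j : ℕ) < t then g j (e y j) else 0)|) := by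
    refine filter_congr fun y _ => ?_
    simp only [hg, he, Equiv.ofBijective_apply, Fin.isValue, Fin.val_zero, add_zero, Fin.val_one]
  rw [hlhs, hcard]
  have h4 : (Fintype.card (Fin 2 → Bool) : ℝ) = 4 := by norm_num [Fintype.card_pi]
  have hexp : (2 * m ^ 2 / (4 ^ 2 * (J : ℝ))) = m ^ 2 / (8 * J) := by ring
  rw [prod_const, card_univ, Fintype.card_fin, h4, hexp] at hband
  exact hband


/-! ### The masked pair walk (only the MID pairs contribute: SPEC S4/S6) -/
/-- **Band estimate for a MASKED pair walk.**  Same as `card_filter_pairWalk_exits_le`, but only the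
pairs `j` selected by a predicate `χ` (the MID pairs `jA ≤ j < jE` of SPEC S4–S6; head and tail pairs
are deterministic and contribute nothing) enter the walk:
`#{y : ∃ t ≤ J, m ≤ |∑_{j<t, χ j} X_j(y)|} ≤ 2J · exp(−m²/(8J)) · 4^J`. [folklore] -/
theorem card_filter_pairWalk_exits_le_of_mask {J : ℕ} (τ : Fin J → Bool) (χ : Fin J → Prop)
    [DecidablePred χ] {m : ℝ} (hm : 0 < m) :
    ((univ.filter fun y : Fin (2 * J) → Bool => ∃ t : ℕ, t ≤ J ∧
        m ≤ |∑ j : Fin J, (if (j : ℕ) < t then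
          (if χ j then
            (if τ j then
              (if y ⟨2 * j.val, by have := j.isLt; omega⟩ = y ⟨2 * j.val + 1, by have := j.isLt; omega⟩
                then (1 : ℝ) else -1)
             else ((if y ⟨2 * j.val, by have := j.isLt; omega⟩ then (1 : ℝ) else -1) +
               (if y ⟨2 * j.val + 1, by have := j.isLt; omega⟩ then (1 : ℝ) else -1)))
           else 0)
          else 0)|).card : ℝ)
      ≤ 2 * J * Real.exp (-(m ^ 2 / (8 * J))) * 4 ^ J := by
  classical
  -- the blocks and the masked centred steps
  set g : ∀ _ : Fin J, (Fin 2 → Bool) → ℝ := fun j u =>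
    if χ j then
      (if τ j then (if u 0 = u 1 then (1 : ℝ) else -1)
       else ((if u 0 then (1 : ℝ) else -1) + (if u 1 then (1 : ℝ) else -1)))
    else 0 with hg
  have hgI : ∀ j u, g j u ∈ Set.Icc (-2 : ℝ) (-2 + 4) := by
    intro j u
    by_cases hχ : χ j
    · simp only [hg, if_pos hχ]; exact pairStep_mem_Icc (τ j) u
    · simp only [hg, if_neg hχ]; norm_num
  have hband := card_filter_exists_abs_prefix_centered_ge_le (κ := fun _ : Fin J => Fin 2 → Bool)
    g (fun _ => -2) (w := 4) (by norm_num) hgI hm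
  have hmean : ∀ j, coordMean (g j) = 0 := by
    intro j
    by_cases hχ : χ j
    · have : g j = fun u : Fin 2 → Bool => if τ j then (if u 0 = u 1 then (1 : ℝ) else -1)
          else ((if u 0 then (1 : ℝ) else -1) + (if u 1 then (1 : ℝ) else -1)) := by
        funext u; simp only [hg, if_pos hχ]
      rw [this]; exact coordMean_pairStep (τ j)
    · have : g j = fun _ : Fin 2 → Bool => (0 : ℝ) := by funext u; simp only [hg, if_neg hχ]
      rw [this]; exact coordMean_const' 0
  simp only [hmean, sub_zero] at hband
  -- transport along the pairing bijection
  set e := Equiv.ofBijective _ (pairs_bijective J) with he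
  have hcard : ((univ.filter fun y : Fin (2 * J) → Bool => ∃ t : ℕ, t ≤ J ∧
      m ≤ |∑ j : Fin J, (if (j : ℕ) < t then g j (e y j) else 0)|).card) =
      ((univ.filter fun z : Fin J → Fin 2 → Bool => ∃ t : ℕ, t ≤ J ∧
        m ≤ |∑ j : Fin J, (if (j : ℕ) < t then g j (z j) else 0)|).card) := by
    rw [← map_univ_equiv e, filter_map, card_map]
    rfl
  have hlhs : (univ.filter fun y : Fin (2 * J) → Bool => ∃ t : ℕ, t ≤ J ∧
        m ≤ |∑ j : Fin J, (if (j : ℕ) < t then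
          (if χ j then
            (if τ j then
              (if y ⟨2 * j.val, by have := j.isLt; omega⟩ = y ⟨2 * j.val + 1, by have := j.isLt; omega⟩
                then (1 : ℝ) else -1)
             else ((if y ⟨2 * j.val, by have := j.isLt; omega⟩ then (1 : ℝ) else -1) +
               (if y ⟨2 * j.val + 1, by have := j.isLt; omega⟩ then (1 : ℝ) else -1)))
           else 0)
          else 0)|) =
      (univ.filter fun y : Fin (2 * J) → Bool => ∃ t : ℕ, t ≤ J ∧
        m ≤ |∑ j : Fin J, (if (j : ℕ) < t then g j (e y j) else 0)|) := by
    refine filter_congr fun y _ => ?_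
    simp only [hg, he, Equiv.ofBijective_apply, Fin.isValue, Fin.val_zero, add_zero, Fin.val_one]
  rw [hlhs, hcard]
  have h4 : (Fintype.card (Fin 2 → Bool) : ℝ) = 4 := by norm_num [Fintype.card_pi]
  have hexp : (2 * m ^ 2 / (4 ^ 2 * (J : ℝ))) = m ^ 2 / (8 * J) := by ring
  rw [prod_const, card_univ, Fintype.card_fin, h4, hexp] at hband
  exact hband

end Summit.ValiantsHypothesis.ValiantsHypothesis.Theorems.FifoMatching.NNLinearDegreeCofactorHard.InternalCofactor

end
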